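import Summits.PneNP.PneNP.Theorems.KrwChromaticSteeringStrongCompositionResidualRectangle

/-!
# Route KrwChromaticSteering, crux `StrongComposition` (stmt-PneNP-18538) — registered stub `stub_chromaticEndgame`

Stub file for the birth skeleton `Summits/PneNP/PneNP/Cruxes/StrongComposition/Lines/birth.lean`
(planner-skel-stmt-PneNP-18538, sha d043782a…) of the crux C1
`Summit.PneNP.PneNP.Theses.KrwChromaticSteering.StrongComposition` (strong composition with `γ = 1`,
Meir 2023, arXiv:2306.00615).  It proves the registered stub

* **`stub_chromaticEndgame : ChromaticEndgame`** (L, PRINTED — Meir 2023, Lemma 8 in family form,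
  Lemma 6 absorbed into the constant): for every family `F` of protocols solving the strong games
  `KW_f ⊛ KW_g` within depth `d` and every bit string `π` with `|π| ≤ d`,
  `|π| + log₂ log₂ χ(G_π) ≤ d + c·(⌊log₂(mn)⌋ + 1)`, with `c = 3`,

where `G_π` is the characteristic graph of the skeleton (`charGraph`, `chi`; objects in
`…StrongCompositionDefs`, p546030).  The proof is Meir's covering argument made explicit as a
DIAGONAL-FREE RECTANGLE COVER of the edges of `G_π` by `≤ 2^r·(4mn+1)` certificates, `r = d − |π|`:
a LEAF certificate (a common consistent continuation of full length `r` of Alice's tree `F g_A` on `X`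
and Bob's tree `F g_B` on `Y`, with Alice's leaf `(i, j)` and her bits `X_{ij}`, `g_A(X_i)`, accepted
by Bob iff `Y_{ij} = X_{ij} ∨ g_B(Y_i) = g_A(X_i)` — always the case under the weak intersection
property) or a CONFLICT certificate (a shorter common continuation after which Alice sits at an Alice
node of her tree and Bob at a Bob node of his).  On the diagonal `g_A = g_B` both players read the
same tree, so a conflict is impossible (`not_both_blocked`) and a leaf certificate contradicts
`SolvesStrong` (`false_of_leaf_certificate`); hence `g ↦ {certificates Alice accepts with g}` is a
proper colouring (`chromaticNumber_toNat_le_of_cover`), `χ(G_π) ≤ 2^(2^r·(4mn+1))`, and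
`log₂ log₂ χ(G_π) ≤ r + ⌊log₂(mn)⌋ + 3`.

Honest framing: this is the printed part of the line (the chromatic ENDGAME bound); the lever
`SteeredTranscript` (≡ C1 given the two printed stubs) is open, C1 is Meir's open problem, and
nothing here bears on P vs NP.
-/

set_option linter.dupNamespace false -- `Summit.PneNP.PneNP.…`: summit = sub-problem name (D-0017 single-conjunct layout)
set_option autoImplicit false

namespace Summit.PneNP.PneNP.Theorems.KrwStrongComposition

open Literature.Computability.Complexity

/-! ### Diagonal-free rectangle covers bound the chromatic number -/

/-- **A diagonal-free rectangle cover by `N` certificates gives a proper `2^N`-colouring.**  If every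
edge `u ~ v` of `G` is COVERED by a certificate `t` accepted by one endpoint as "Alice" and by the
other as "Bob" (`A u t ∧ B v t`, in one of the two orders), and no vertex accepts a certificate in
both roles (DIAGONAL-FREE: `¬ (A v t ∧ B v t)`), then `v ↦ {t | A v t}` is a proper colouring by
subsets of the certificate type, so `χ(G) ≤ 2 ^ N`.  (The rectangles are `{u | A u t} × {v | B v t}`.)
[cite: Meir2023, §4.2 (proof of Lemma 8: `χ ≤ 2^{number of witnesses}`); folklore] -/
theorem chromaticNumber_toNat_le_of_cover {V C : Type*} [Fintype C] (G : SimpleGraph V)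
    (A B : V → C → Prop)
    (hcov : ∀ u v, G.Adj u v → (∃ t, A u t ∧ B v t) ∨ (∃ t, A v t ∧ B u t))
    (hdiag : ∀ v t, A v t → B v t → False) :
    G.chromaticNumber.toNat ≤ 2 ^ Fintype.card C := by
  classical
  let col : G.Coloring (Set C) := SimpleGraph.Coloring.mk (fun v => {t | A v t}) (by
    intro u v huv heq
    rcases hcov u v huv with ⟨t, hAt, hBt⟩ | ⟨t, hAt, hBt⟩
    · have ht : t ∈ {t | A v t} := by rw [← heq]; exact hAt
      exact hdiag v t ht hBt
    · have ht : t ∈ {t | A u t} := by rw [heq]; exact hAt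
      exact hdiag u t ht hBt)
  have hc : G.Colorable (Fintype.card (Set C)) := col.colorable
  rw [Fintype.card_set] at hc
  exact ENat.toNat_le_of_le_coe hc.chromaticNumber_le

/-! ### The certificates of the characteristic graph -/

section Certificates

variable {m n : ℕ}

/-- **No LEAF certificate on the diagonal.**  If `X ∈ 𝒳_π(g)` and `Y ∈ 𝒴_π(g)` (the SAME inner function
`g`) reach the leaf `p = (i, j)` of the common tree `F g`, then `SolvesStrong` forces `X_{ij} ≠ Y_{ij}`
AND `g(X_i) ≠ g(Y_i)`; so Bob cannot accept Alice's announced leaf bits `β = X_{ij}`, `α = g(X_i)` under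
the acceptance rule "`Y_{ij} = β` or `g(Y_i) = α`". [cite: Meir2023, §4.2 (proof of Lemma 8, the
diagonal is refuted by the correctness of the common protocol)] -/
theorem false_of_leaf_certificate {f : (Fin m → Bool) → Bool} {F : Family m n} {π : List Bool}
    {g : (Fin n → Bool) → Bool} (hF : (F g).SolvesStrong f g) {X Y : Fin m × Fin n → Bool}
    (hX : X ∈ Xset f F π g) (hY : Y ∈ Yset f F π g) {p : Fin m × Fin n} (hrun : (F g).run X Y = p)
    {β α : Bool} (hβ : X p = β) (hα : g (row X p.1) = α) (hBob : Y p = β ∨ g (row Y p.1) = α) :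
    False := by
  obtain ⟨hX1, -⟩ := hX
  obtain ⟨hY0, -⟩ := hY
  obtain ⟨hne, hlab⟩ := hF X Y hX1 hY0
  rw [hrun] at hne hlab
  simp only [rowLabels_apply] at hlab
  rcases hBob with h | h
  · exact hne (hβ.trans h.symm)
  · exact hlab (hα.trans h.symm)

/-- **Every weak-intersection edge is covered by a certificate.**  Let `X ∈ 𝒳_π(g_A)`, `Y ∈ 𝒴_π(g_B)`
witness the weak intersection property and let every tree of the family have depth `≤ |π| + r`.  Walk
the two trees `F g_A` (Alice, on `X`) and `F g_B` (Bob, on `Y`) jointly for `r` rounds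
(`exists_walk`).  EITHER a continuation `σ` of full length `r` consistent for both exists — then
Alice's leaf `p = (i, j)` is determined (`exists_leaf_of_aliceConsistent`) and Bob accepts her leaf
bits `β = X_{ij}`, `α = g_A(X_i)` because the weak intersection property gives `g_B(Y_i) = g_A(X_i)` or
`Y_i = X_i` (a LEAF certificate) — OR a shorter common continuation ends in a CONFLICT round (Alice at
an Alice node of `F g_A`, Bob at a Bob node of `F g_B`: a CONFLICT certificate).
[cite: Meir2023, §4.2 (proof of Lemma 8), Def. 22] -/
theorem exists_certificate (f : (Fin m → Bool) → Bool) (F : Family m n) (π : List Bool) (r : ℕ)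
    (hd : ∀ g, (F g).depth ≤ π.length + r) {gA gB : (Fin n → Bool) → Bool}
    (hW : WIP f F π gA gB) :
    (∃ (σ : List Bool) (p : Fin m × Fin n) (β α : Bool), σ.length = r ∧
        (∃ X ∈ Xset f F π gA, AliceConsistent (F gA) X (π ++ σ) ∧
          (∀ Y', BobConsistent (F gA) Y' (π ++ σ) → (F gA).run X Y' = p) ∧
            X p = β ∧ gA (row X p.1) = α) ∧
        (∃ Y ∈ Yset f F π gB, BobConsistent (F gB) Y (π ++ σ) ∧ (Y p = β ∨ gB (row Y p.1) = α))) ∨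
      (∃ σ : List Bool, σ.length < r ∧
        (∃ X ∈ Xset f F π gA, AliceConsistent (F gA) X (π ++ σ) ∧
          ∃ b, ¬ AliceConsistent (F gA) X (π ++ σ ++ [b])) ∧
        (∃ Y ∈ Yset f F π gB, BobConsistent (F gB) Y (π ++ σ) ∧
          ∃ b, ¬ BobConsistent (F gB) Y (π ++ σ ++ [b]))) := by
  obtain ⟨X, hX, Y, hY, hWI⟩ := hW
  have hX' := hX
  have hY' := hY
  obtain ⟨-, hXπ⟩ := hX'
  obtain ⟨-, hYπ⟩ := hY'
  obtain ⟨σ, hAσ, hBσ, hcase⟩ := exists_walk (F gA) (F gB) X Y π hXπ hYπ r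
  rcases hcase with hlen | ⟨hlt, b, b', hb, hb'⟩
  · have hdep : (F gA).depth ≤ (π ++ σ).length := by
      rw [List.length_append, hlen]
      exact hd gA
    obtain ⟨p, hp⟩ := exists_leaf_of_aliceConsistent (π ++ σ) (F gA) X hAσ hdep
    refine Or.inl ⟨σ, p, X p, gA (row X p.1), hlen, ⟨X, hX, hAσ, hp, rfl, rfl⟩, ⟨Y, hY, hBσ, ?_⟩⟩
    by_cases hlab : gA (row X p.1) = gB (row Y p.1)
    · exact Or.inr hlab.symm
    · have hrow : row X p.1 = row Y p.1 := hWI p.1 (by simpa only [rowLabels_apply] using hlab)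
      have hentry := congrFun hrow p.2
      simp only [row_apply, Prod.mk.eta] at hentry
      exact Or.inl hentry.symm
  · exact Or.inr ⟨σ, hlt, ⟨X, hX, hAσ, b, hb⟩, ⟨Y, hY, hBσ, b', hb'⟩⟩

end Certificates

/-! ### The registered stub `stub_chromaticEndgame` -/

/-- **Registered stub `stub_chromaticEndgame` of the birth skeleton of `StrongComposition`** — MEIR'S
LEMMA 8 IN FAMILY FORM (L-sized, PRINTED; Lemma 6 absorbed into the constant): for a family `F` of
protocols solving the strong games `KW_f ⊛ KW_g` within depth `d` and any bit string `π` with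
`|π| ≤ d`, `|π| + log₂ log₂ χ(G_π) ≤ d + 3·(⌊log₂(mn)⌋ + 1)`.

Proof.  Let `r = d − |π|`.  The certificate type is
`C = (Vector Bool r × (Fin m × Fin n) × Bool × Bool) ⊕ (Σ k < r, Vector Bool k)`, of cardinality
`2^r · 4mn + (2^r − 1) ≤ 2^r · (4mn + 1)`.  Alice (holding `g`) accepts a LEAF certificate
`(τ, (i,j), β, α)` iff some `X ∈ 𝒳_π(g)` is consistent with `π ++ τ` along `F g`, reaches the leaf
`(i, j)` against every consistent Bob input, and has `X_{ij} = β`, `g(X_i) = α`; Bob (holding `g`)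
accepts it iff some `Y ∈ 𝒴_π(g)` is consistent with `π ++ τ` and `Y_{ij} = β ∨ g(Y_i) = α`.  Alice
accepts a CONFLICT certificate `σ` (`|σ| < r`) iff some `X ∈ 𝒳_π(g)` is consistent with `π ++ σ` but
blocked at the next round (an Alice node of `F g`); Bob likewise with a Bob node.  Every edge of `G_π`
is covered (`exists_certificate`) and no `g` accepts a certificate in both roles
(`false_of_leaf_certificate`, `not_both_blocked` — on the diagonal both players read the same tree),
so `χ(G_π) ≤ 2^|C|` (`chromaticNumber_toNat_le_of_cover`), whence
`log₂ log₂ χ ≤ log₂ |C| ≤ r + ⌊log₂(mn)⌋ + 3` and `|π| + log₂ log₂ χ ≤ d + ⌊log₂(mn)⌋ + 3`.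
[cite: Meir2023, Lemma 8 and its proof (§4.2), Def. 22; folklore (clique vs. rectangle covers)] -/
theorem stub_chromaticEndgame :
    ∃ c : ℕ, ∀ (m n : ℕ) (f : (Fin m → Bool) → Bool) (F : Family m n) (d : ℕ) (π : List Bool),
      (∀ g, (F g).SolvesStrong f g) → (∀ g, (F g).depth ≤ d) → π.length ≤ d →
        π.length + Nat.log 2 (Nat.log 2 (chi f F π)) ≤ d + c * (Nat.log 2 (m * n) + 1) := by
  refine ⟨3, fun m n f F d π hF hd hπ => ?_⟩
  classical
  obtain ⟨r, hr⟩ : ∃ r, d = π.length + r := ⟨d - π.length, by omega⟩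
  have hd' : ∀ g, (F g).depth ≤ π.length + r := fun g => hr ▸ hd g
  -- χ(G_π) ≤ 2 ^ (number of certificates)
  have hbound : (charGraph f F π).chromaticNumber.toNat ≤
      2 ^ Fintype.card ((List.Vector Bool r × (Fin m × Fin n) × Bool × Bool) ⊕
        (Σ k : Fin r, List.Vector Bool k)) :=
    chromaticNumber_toNat_le_of_cover (charGraph f F π)
      (fun g => Sum.elim
        (fun c => ∃ X ∈ Xset f F π g, AliceConsistent (F g) X (π ++ c.1.toList) ∧
          (∀ Y', BobConsistent (F g) Y' (π ++ c.1.toList) → (F g).run X Y' = c.2.1) ∧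
            X c.2.1 = c.2.2.1 ∧ g (row X c.2.1.1) = c.2.2.2)
        (fun c => ∃ X ∈ Xset f F π g, AliceConsistent (F g) X (π ++ c.2.toList) ∧
          ∃ b, ¬ AliceConsistent (F g) X (π ++ c.2.toList ++ [b])))
      (fun g => Sum.elim
        (fun c => ∃ Y ∈ Yset f F π g, BobConsistent (F g) Y (π ++ c.1.toList) ∧
          (Y c.2.1 = c.2.2.1 ∨ g (row Y c.2.1.1) = c.2.2.2))
        (fun c => ∃ Y ∈ Yset f F π g, BobConsistent (F g) Y (π ++ c.2.toList) ∧
          ∃ b, ¬ BobConsistent (F g) Y (π ++ c.2.toList ++ [b])))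
      (by
        rintro gA gB ⟨-, hW | hW⟩
        · rcases exists_certificate f F π r hd' hW with
            ⟨σ, p, β, α, hlen, hAlice, hBob⟩ | ⟨σ, hlt, hAlice, hBob⟩
          · exact Or.inl ⟨Sum.inl (⟨σ, hlen⟩, p, β, α), hAlice, hBob⟩
          · exact Or.inl ⟨Sum.inr ⟨⟨σ.length, hlt⟩, ⟨σ, rfl⟩⟩, hAlice, hBob⟩
        · rcases exists_certificate f F π r hd' hW with
            ⟨σ, p, β, α, hlen, hAlice, hBob⟩ | ⟨σ, hlt, hAlice, hBob⟩
          · exact Or.inr ⟨Sum.inl (⟨σ, hlen⟩, p, β, α), hAlice, hBob⟩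
          · exact Or.inr ⟨Sum.inr ⟨⟨σ.length, hlt⟩, ⟨σ, rfl⟩⟩, hAlice, hBob⟩)
      (by
        rintro g (⟨τ, p, β, α⟩ | ⟨k, σ⟩) hAcc hBcc
        · obtain ⟨X, hX, hXc, hleaf, hβ, hα⟩ := hAcc
          obtain ⟨Y, hY, hYc, hBob⟩ := hBcc
          exact false_of_leaf_certificate (hF g) hX hY (hleaf Y hYc) hβ hα hBob
        · obtain ⟨X, -, hXc, b, hb⟩ := hAcc
          obtain ⟨Y, -, hYc, b', hb'⟩ := hBcc
          exact not_both_blocked _ (F g) X Y b b' hXc hYc hb hb')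
  -- counting the certificates
  have hgeom : ∑ k : Fin r, 2 ^ (k : ℕ) < 2 ^ r := by
    rw [Fin.sum_univ_eq_sum_range (fun k => 2 ^ k) r]
    exact Nat.geomSum_lt (le_refl 2) fun k hk => Finset.mem_range.1 hk
  have hcard : Fintype.card ((List.Vector Bool r × (Fin m × Fin n) × Bool × Bool) ⊕
      (Σ k : Fin r, List.Vector Bool k)) ≤ 2 ^ r * (4 * (m * n) + 1) := by
    simp only [Fintype.card_sum, Fintype.card_prod, card_vector, Fintype.card_bool,
      Fintype.card_fin, Fintype.card_sigma]
    have h4 : 2 ^ r * (m * n * (2 * 2)) + 2 ^ r = 2 ^ r * (4 * (m * n) + 1) := by ring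
    omega
  have hmn : m * n < 2 ^ (Nat.log 2 (m * n) + 1) := Nat.lt_pow_succ_log_self one_lt_two _
  have hN : 2 ^ r * (4 * (m * n) + 1) ≤ 2 ^ (r + (Nat.log 2 (m * n) + 3)) := by
    rw [pow_add 2 r]
    apply Nat.mul_le_mul_left
    have h8 : 2 ^ (Nat.log 2 (m * n) + 3) = 2 ^ (Nat.log 2 (m * n) + 1) * 4 := by ring
    omega
  have h1 : chi f F π ≤ 2 ^ 2 ^ (r + (Nat.log 2 (m * n) + 3)) := by
    unfold chi
    exact hbound.trans (Nat.pow_le_pow_right two_pos (hcard.trans hN))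
  have h2 : Nat.log 2 (chi f F π) ≤ 2 ^ (r + (Nat.log 2 (m * n) + 3)) := by
    have := Nat.log_mono_right (b := 2) h1
    rwa [Nat.log_pow one_lt_two] at this
  have h3 : Nat.log 2 (Nat.log 2 (chi f F π)) ≤ r + (Nat.log 2 (m * n) + 3) := by
    have := Nat.log_mono_right (b := 2) h2
    rwa [Nat.log_pow one_lt_two] at this
  omega

end Summit.PneNP.PneNP.Theorems.KrwStrongComposition
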